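import Mathlib
import HarnessLib
import Literature.Analysis.FluidPDE.HelicityDensityPseudoscalar
import Literature.Analysis.FluidPDE.CurlFreeLiouville
import Literature.Analysis.FluidPDE.IsometryInvariance
import Literature.Analysis.FluidPDE.NSVelocityUniqueness
import Literature.Analysis.FluidPDE.VorticityCalculus
import Summits.NavierStokesRegularity.NavierStokesRegularity.Theorems.UnthreadedDoorAntidynamoWallOneInstantZonal
import Summits.NavierStokesRegularity.NavierStokesRegularity.Theorems.UnthreadedDoorAntidynamoWallSteadyCore

/-!
# Route `UnthreadedDoor` / `ThreadingFlux`, crux `PoloidalLiouville` (stmt-NavierStokesRegularity-1222), antidynamo v2 skeleton (sha16 `4ebf5683127b`),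
# WALL `stub_scalarLiouville`: ★★★ ONE-INSTANT RIGID SYMMETRY — vorticity symmetric under a rigid motion at ONE instant ⇒ irrotational, or symmetric
# about the centre `x₀` at EVERY instant (hence, by the landed dichotomy, with an exactly equivariant velocity)

Support file (seat leafhand-ns-unthreadeddoor-2 g2, cell decomp-ns), `--supports stmt-NavierStokesRegularity-1222 --as helper`; theorems only.

The g0/g1 sector tables close or reduce every SYMMETRIC sector of the wall (`R`-pseudo-symmetric vorticity about `x₀`: irrotational, or velocity exactly
`R`-equivariant — `curl_eq_zero_or_equivariant_of_curl_symmetric`, p816327) under symmetry at ALL times (or on a far past / at accumulating times).  With the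
Oseen gauge, the constant Galilean boost (`Theorems.stub_oseen_const_boost`) and one-slice propagation of conjugation symmetries (`conj_eq_of_slice`), ONE
instant suffices, and the centre of symmetry need not even be `x₀`:

* §1 `conj_sub_centre_eq_of_curl_symmetric` (kinematics, one slice): a bounded `C²` divergence-free field whose curl is symmetric as a pseudovector under the
  rigid motion `y ↦ p + R(y − p)` is, minus its value at `p`, EXACTLY `R`-equivariant about `p` (the conjugate minus the field is bounded, divergence free
  and curl free, hence constant — KNSS Lemma 3.1 / `eq_of_curl_eq_zero_of_isDivFree_of_bounded`).
* §2 `conj_eq_boost_of_slice` (dynamics, bounded Oseen-ancient class): exact `R`-equivariance of `W(t₁) − k` about `p` at ONE time ⇒ exact `R`-equivariance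
  about `p` of the boosted field `W♭(t) = W(t, · + (t − t₁)k) − k` at EVERY `t < 0`.
* §3 ★★★ `curl_eq_zero_or_curl_symmetric_of_curl_symmetric_slice`: let `v` be in the wall's class (bounded ancient mild, measurable slices, jointly smooth,
  vorticity tangent to the spheres about `x₀`).  If at ONE `t₁ < 0` the vorticity is `R`-symmetric as a pseudovector about SOME centre `x₁`
  (`curl v(t₁)(x₁ + R y) = det R • R (curl v(t₁)(x₁ + y))`), then EITHER `curl v ≡ 0` on `(−∞,0) × ℝ³` OR the vorticity is `R`-symmetric about `x₀` ITSELF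
  at EVERY `t < 0`.  [Gauge + §1 + §2 make `v(t) − κ(t)` exactly `R`-equivariant about a moving centre `q(t)`; unthreadedness about `x₀` then exhibits the
  SECOND CENTRE `q(t) − R⁻¹(q(t) − x₀)`, so either it differs from `x₀` at some instant — a flat direction at one instant, trivial by the one-instant Z
  `curl_eq_zero_of_flat_direction_slice` — or `R` fixes `q(t) − x₀` at every instant and the symmetry about `q(t)` is symmetry about `x₀`.]
* ★★★ `curl_eq_zero_or_equivariant_of_curl_symmetric_slice`: … hence EITHER `curl v ≡ 0` OR `v(t, x₀ + R y) = R v(t, x₀ + y)` for ALL `t < 0` (chain with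
  p816327): every symmetric sector of the g0/g1 tables is now entered through ONE instant and ANY centre.
* `curl_eq_zero_of_two_centres_slice`: a SECOND CENTRE of tangency at ONE instant ⇒ trivial (flat direction `x₁ − x₀`).

HONEST LABEL: assembly over landed theorems; nothing here proves `stub_scalarLiouville`, `PoloidalLiouville` (1222), or bears on Navier–Stokes regularity; no
summit statement is proved (crux 1222 is INCOMPARABLE with the summit). [folklore] [cite: KochNadirashviliSereginSverak2009, Lemma 3.1, Thm 5.2 and §4
(arXiv:0709.3599 pp. 6–10); MajdaBertozziCUP2002, §1.2; ArfkenWeber1995, §2.9]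
-/

noncomputable section

-- the summit and its single sub-problem share the name (CONVENTIONS §1)
set_option linter.dupNamespace false

open scoped Topology InnerProductSpace RealInnerProductSpace ContDiff
open Filter Set Function Metric MeasureTheory
open Literature.Analysis Literature.Analysis.FluidPDE

namespace Summit.NavierStokesRegularity.NavierStokesRegularity.Theorems.PoloidalLiouville.Antidynamo

open Summit.NavierStokesRegularity.NavierStokesRegularity.Theorems.PoloidalLiouville
  (toroidalPotential exists_norm_curl_le constantOfIrrotational)
open Summit.NavierStokesRegularity.NavierStokesRegularity.Theorems.PoloidalLiouville.NetFlux (E3)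
open Summit.NavierStokesRegularity.NavierStokesRegularity.Theorems.PoloidalWindowDoorPoloidalWindowRigidityOneSlice
  (conj_eq_of_slice)

namespace OneInstant

/-! ### §1 Kinematics: symmetric curl ⇒ exactly equivariant field, up to the value at the centre -/

/-- **SYMMETRIC CURL ⇒ EQUIVARIANT FIELD UP TO A CONSTANT.**  A bounded `C²` divergence-free field `u` on `ℝ³` whose curl is `R`-symmetric as a pseudovector
about `p` (`curl u (p + R y) = det R • R (curl u (p + y))`) satisfies `R (u(p + R⁻¹y) − u(p)) = u(p + y) − u(p)`: the rigidly moved field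
`x ↦ R (u (R⁻¹x + p − R⁻¹p))` minus `u` is bounded, divergence free and curl free (`curl_conj_rigidMotion`), hence constant (KNSS 2009 Lemma 3.1, tree
`eq_of_curl_eq_zero_of_isDivFree_of_bounded`), and the constant is read off at the centre. [cite: KochNadirashviliSereginSverak2009, Lemma 3.1 (arXiv:0709.3599 p. 6); ArfkenWeber1995, §2.9] -/
theorem conj_sub_centre_eq_of_curl_symmetric {u : E3 → E3} (hu : ContDiff ℝ 2 u) {M : ℝ} (hM : ∀ x, ‖u x‖ ≤ M)
    (hdiv : VectorCalculus.IsDivFree u) (R : E3 ≃ₗᵢ[ℝ] E3) (p : E3)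
    (hsym : ∀ y, curl u (p + R y) = (R : E3 →L[ℝ] E3).det • R (curl u (p + y))) :
    ∀ y, R (u (p + R.symm y) - u p) = u (p + y) - u p := by
  set c : E3 := p - R.symm p with hc
  set g : E3 → E3 := fun x => R (u (R.symm x + c)) with hg
  have hud : Differentiable ℝ u := hu.differentiable (by norm_num)
  have hg2 : ContDiff ℝ 2 g := R.contDiff.comp (hu.comp (R.symm.contDiff.add contDiff_const))
  have hgd : Differentiable ℝ g := hg2.differentiable (by norm_num)
  set f : E3 → E3 := fun x => g x - u x with hf
  have hf2 : ContDiff ℝ 2 f := hg2.sub hu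
  have hfcurl : ∀ x, curl f x = 0 := fun x => by
    rw [hf, curl_sub (hgd x) (hud x), hg, curl_conj_rigidMotion R c u x]
    have e1 : R.symm x + c = p + R.symm (x - p) := by
      rw [hc, map_sub]
      abel
    rw [e1, ← hsym, LinearIsometryEquiv.apply_symm_apply, add_sub_cancel, sub_self]
  have hgdiv : VectorCalculus.IsDivFree g := (hdiv.comp_add_right c).conj_linearIsometryEquiv R
  have hfdiv : VectorCalculus.IsDivFree f := hgdiv.sub hgd hud hdiv
  have hfM : ∀ x, ‖f x‖ ≤ M + M := fun x => by
    refine (norm_sub_le _ _).trans (add_le_add ?_ (hM x))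
    rw [hg, LinearIsometryEquiv.norm_map]
    exact hM _
  intro y
  have key := eq_of_curl_eq_zero_of_isDivFree_of_bounded hf2 hfcurl hfdiv hfM (p + y) p
  have e2 : R.symm (p + y) + c = p + R.symm y := by
    rw [hc, map_add]
    abel
  have e3 : R.symm p + c = p := by
    rw [hc]
    abel
  simp only [hf, hg, e2, e3] at key
  -- `key : R (u (p + R⁻¹ y)) - u (p + y) = R (u p) - u p`
  rw [map_sub, sub_eq_sub_iff_add_eq_add] at *
  rw [key, add_comm]

/-! ### §2 Dynamics: one exactly equivariant slice, up to a constant ⇒ equivariant at every time in the boosted frame -/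

/-- **ONE EXACTLY EQUIVARIANT SLICE UP TO A CONSTANT ⇒ EQUIVARIANT AT EVERY TIME IN THE BOOSTED FRAME.**  Let `W` be bounded Oseen-ancient with weakly
divergence-free slices.  If at ONE time `t₁ < 0` the slice `W(t₁) − k` is exactly `R`-equivariant about `p`, then the boosted field
`W♭(t) = W(t, · + (t − t₁)k) − k` is exactly `R`-equivariant about `p` at EVERY `t < 0` (§1 of the frame lemma file + `conj_eq_of_slice`).
[cite: KochNadirashviliSereginSverak2009, §1 p. 3 and §4 (arXiv:0709.3599 pp. 3, 8); MajdaBertozziCUP2002, §1.2] -/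
theorem conj_eq_boost_of_slice {W : ℝ → E3 → E3}
    (hc : ContinuousOn (uncurry W) (Iio (0 : ℝ) ×ˢ univ)) (hb : ∃ K : ℝ, ∀ t < 0, ∀ y, ‖W t y‖ ≤ K)
    (hdiv : ∀ t < 0, IsWeaklyDivFree (W t))
    (hm : ∀ s t : ℝ, s < t → t < 0 → ∀ y,
      W t y = UnboundedOperators.heatExtension (W s) (t - s) y - oseenDuhamel 1 s W W t y)
    (R : E3 ≃ₗᵢ[ℝ] E3) {p k : E3} {t₁ : ℝ} (ht₁ : t₁ < 0)
    (h₁ : ∀ y, R (W t₁ (p + R.symm y) - k) = W t₁ (p + y) - k) :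
    ∀ t < 0, ∀ y, R ((fun t y => W t (y + (t - t₁) • k) - k) t (p + R.symm y)) =
      (fun t y => W t (y + (t - t₁) • k) - k) t (p + y) := by
  obtain ⟨hc', hb', hm'⟩ := oseenAncient_boost hc hb hdiv hm k t₁
  obtain ⟨hcU, hbU, hmU⟩ := oseenAncient_translate hc' hb' hm' p
  have hbdd : ∀ δ : ℝ, 0 < δ → ∃ B : ℝ, ∀ t < -δ, ∀ y : E3,
      ‖(fun t y => (fun t y => W t (y + (t - t₁) • k) - k) t (y + p)) t y‖ ≤ B := fun δ hδ => by
    obtain ⟨K, hK⟩ := hbU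
    exact ⟨K, fun t ht y => hK t (by linarith) y⟩
  have hslice : ∀ y, R ((fun t y => (fun t y => W t (y + (t - t₁) • k) - k) t (y + p)) t₁ (R.symm y)) =
      (fun t y => (fun t y => W t (y + (t - t₁) • k) - k) t (y + p)) t₁ y := fun y => by
    have h := h₁ y
    simp only [sub_self, zero_smul, add_zero]
    rw [add_comm (R.symm y) p, add_comm y p]
    exact h
  intro t ht y
  have h := conj_eq_of_slice hcU hbdd hmU R ht₁ hslice t ht y
  simp only at h ⊢
  rw [add_comm p (R.symm y), add_comm p y]
  exact h

/-! ### §3 ★★★ One-instant rigid symmetry in the wall's class -/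

/-- ★★★ **VORTICITY SYMMETRIC UNDER A RIGID MOTION AT ONE INSTANT ⇒ IRROTATIONAL, OR SYMMETRIC ABOUT `x₀` AT EVERY INSTANT.**  Let `v` be a bounded ancient
mild solution (`ν = 1`, duality class) with measurable slices, jointly smooth on `(−∞,0) × ℝ³`, with vorticity tangent to the spheres about `x₀`.  If for ONE
`t₁ < 0`, ONE linear isometry `R` and ONE centre `x₁`, `curl v(t₁)(x₁ + R y) = det R • R (curl v(t₁)(x₁ + y))` for all `y`, then EITHER `curl v ≡ 0` on
`(−∞,0) × ℝ³` OR `curl v(t)(x₀ + R y) = det R • R (curl v(t)(x₀ + y))` for ALL `t < 0` and `y` (module docstring for the proof).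
[cite: KochNadirashviliSereginSverak2009, Lemma 3.1, Thm 5.2, §4 (arXiv:0709.3599 pp. 6–10); MajdaBertozziCUP2002, §1.2] -/
theorem curl_eq_zero_or_curl_symmetric_of_curl_symmetric_slice
    (v : ℝ → EuclideanSpace ℝ (Fin 3) → EuclideanSpace ℝ (Fin 3)) (x₀ : EuclideanSpace ℝ (Fin 3))
    (hB : Literature.Analysis.FluidPDE.IsBoundedAncientMildSolution 1 v)
    (hm : ∀ t < 0, AEStronglyMeasurable (v t) volume)
    (hsm : ContDiffOn ℝ (⊤ : ℕ∞) (Function.uncurry v) (Set.Iio 0 ×ˢ Set.univ))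
    (hun : ∀ t < 0, ∀ x, ⟪x - x₀, curl (v t) x⟫ = 0)
    (R : EuclideanSpace ℝ (Fin 3) ≃ₗᵢ[ℝ] EuclideanSpace ℝ (Fin 3)) (x₁ : EuclideanSpace ℝ (Fin 3)) {t₁ : ℝ} (ht₁ : t₁ < 0)
    (hsym₁ : ∀ y, curl (v t₁) (x₁ + R y) =
      (R : EuclideanSpace ℝ (Fin 3) →L[ℝ] EuclideanSpace ℝ (Fin 3)).det • R (curl (v t₁) (x₁ + y))) :
    (∀ t < 0, ∀ x, curl (v t) x = 0) ∨
      ∀ t < 0, ∀ y, curl (v t) (x₀ + R y) =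
        (R : EuclideanSpace ℝ (Fin 3) →L[ℝ] EuclideanSpace ℝ (Fin 3)).det • R (curl (v t) (x₀ + y)) := by
  have hsm' : IsSmoothSpaceTimeOn (Iio 0) v := hsm
  -- ## the Oseen gauge, everywhere
  obtain ⟨w, A, c, -, hwc, ⟨K, hK⟩, hwdiv, hwmild, -, hrep⟩ := Theorems.oseen_gauge_of_aestronglyMeasurable v hB hm
  have hrep' : ∀ s < 0, ∀ y, v s y = w s (y - A s) + c s :=
    fun s hs y => CellFlux.galilean_rep_everywhere hsm.continuousOn hwc hrep hs y
  have hws : ∀ s < 0, w s = fun y => v s (y + A s) - c s := fun s hs => by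
    funext y
    have h := hrep' s hs (y + A s)
    rw [add_sub_cancel_right] at h
    rw [h, add_sub_cancel_right]
  have hw_smooth : ∀ s < 0, ContDiff ℝ (⊤ : ℕ∞) (w s) := fun s hs => by
    rw [hws s hs]
    exact ((hsm'.contDiff_slice hs).comp (contDiff_id.add contDiff_const)).sub contDiff_const
  have hw_curl : ∀ s < 0, ∀ y, curl (w s) y = curl (v s) (y + A s) := fun s hs y => by
    rw [hws s hs, CellFlux.curl_comp_add_sub_const]
  -- ## the slice at `t₁`: symmetric curl about `p₀`, hence exactly equivariant up to `k`
  set p₀ : E3 := x₁ - A t₁ with hp₀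
  have hw2 : ContDiff ℝ 2 (w t₁) := (hw_smooth t₁ ht₁).of_le (by norm_cast)
  have hw1 : ContDiff ℝ 1 (w t₁) := (hw_smooth t₁ ht₁).of_le (by norm_cast)
  have hwdiv₁ : VectorCalculus.IsDivFree (w t₁) := (hwdiv t₁ ht₁).isDivFree_of_contDiff hw1
  have hsymw : ∀ y, curl (w t₁) (p₀ + R y) =
      (R : EuclideanSpace ℝ (Fin 3) →L[ℝ] EuclideanSpace ℝ (Fin 3)).det • R (curl (w t₁) (p₀ + y)) := fun y => by
    rw [hw_curl t₁ ht₁, hw_curl t₁ ht₁]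
    have e1 : p₀ + R y + A t₁ = x₁ + R y := by rw [hp₀]; abel
    have e2 : p₀ + y + A t₁ = x₁ + y := by rw [hp₀]; abel
    rw [e1, e2]
    exact hsym₁ y
  set k : E3 := w t₁ p₀ with hk
  have hk₁ : ∀ y, R (w t₁ (p₀ + R.symm y) - k) = w t₁ (p₀ + y) - k :=
    conj_sub_centre_eq_of_curl_symmetric hw2 (fun y => hK t₁ ht₁ y) hwdiv₁ R p₀ hsymw
  -- ## the boosted representative is exactly equivariant about `p₀` at every time
  have hconj := conj_eq_boost_of_slice hwc ⟨K, hK⟩ hwdiv hwmild R ht₁ hk₁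
  -- ## back to `v`: `v t − κ t` is exactly `R`-equivariant about the moving centre `q t`
  set q : ℝ → E3 := fun t => p₀ + (A t + (t - t₁) • k) with hq
  set κ : ℝ → E3 := fun t => k + c t with hκ
  have hvW : ∀ t < 0, ∀ z, v t (q t + z) - κ t = (fun t y => w t (y + (t - t₁) • k) - k) t (p₀ + z) := by
    intro t ht z
    simp only [hκ, hq]
    rw [hrep' t ht]
    have e1 : p₀ + (A t + (t - t₁) • k) + z - A t = p₀ + z + (t - t₁) • k := by abel
    rw [e1]
    abel
  have heqv : ∀ t < 0, ∀ y, R (v t (q t + R.symm y) - κ t) = v t (q t + y) - κ t := by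
    intro t ht y
    rw [hvW t ht, hvW t ht]
    exact hconj t ht y
  -- ## the vorticity is `R`-symmetric about `q t`
  have hsymq : ∀ t < 0, ∀ y, curl (v t) (q t + R y) =
      (R : EuclideanSpace ℝ (Fin 3) →L[ℝ] EuclideanSpace ℝ (Fin 3)).det • R (curl (v t) (q t + y)) := by
    intro t ht y
    set c' : E3 := q t - R.symm (q t) with hc'
    have hvx : v t = fun x => R ((fun z => v t z - κ t) (R.symm x + c')) + κ t := by
      funext x
      have h := heqv t ht (x - q t)
      have e1 : q t + R.symm (x - q t) = R.symm x + c' := by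
        rw [hc', map_sub]
        abel
      rw [e1, add_sub_cancel] at h
      simp only
      rw [h, sub_add_cancel]
    have hcurl : ∀ x, curl (v t) x =
        (R : EuclideanSpace ℝ (Fin 3) →L[ℝ] EuclideanSpace ℝ (Fin 3)).det • R (curl (v t) (R.symm x + c')) := by
      intro x
      conv_lhs => rw [hvx]
      rw [curl_eq_curlCLM, fderiv_add_const, ← curl_eq_curlCLM, curl_conj_rigidMotion R c' (fun z => v t z - κ t) x]
      congr 2
      rw [curl_eq_curlCLM, curl_eq_curlCLM, fderiv_sub_const]
    rw [hcurl (q t + R y)]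
    have e2 : R.symm (q t + R y) + c' = q t + y := by
      rw [hc', map_add, LinearIsometryEquiv.symm_apply_apply]
      abel
    rw [e2]
  -- ## the second centre: `curl v t ⊥ (q t − x₀) − R⁻¹(q t − x₀)`
  have hflat : ∀ t < 0, ∀ z, ⟪(q t - x₀) - R.symm (q t - x₀), curl (v t) z⟫ = 0 := by
    intro t ht z
    have h1 := hun t ht (q t + R (z - q t))
    rw [hsymq t ht, add_sub_cancel, inner_smul_right] at h1
    have h2 : ⟪q t + R (z - q t) - x₀, R (curl (v t) z)⟫ = 0 := (mul_eq_zero.1 h1).resolve_left (CellFlux.det_ne_zero R)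
    have e1 : q t + R (z - q t) - x₀ = R (R.symm (q t - x₀) + (z - q t)) := by
      rw [map_add, LinearIsometryEquiv.apply_symm_apply]
      abel
    rw [e1, LinearIsometryEquiv.inner_map_map] at h2
    have h3 := hun t ht z
    have e2 : (q t - x₀) - R.symm (q t - x₀) = (z - x₀) - (R.symm (q t - x₀) + (z - q t)) := by abel
    rw [e2, inner_sub_left, h3, h2, sub_zero]
  -- ## case A: the second centre differs from `x₀` at some instant — a flat direction at one instant
  by_cases hA : ∃ t < 0, (q t - x₀) - R.symm (q t - x₀) ≠ 0
  · obtain ⟨t, ht, hne⟩ := hA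
    exact Or.inl (curl_eq_zero_of_flat_direction_slice v x₀ hB hm hsm hun ⟨t, ht, _, hne, hflat t ht⟩)
  -- ## case B: `R` fixes `q t − x₀` at every instant — symmetry about `q t` is symmetry about `x₀`
  right
  intro t ht y
  have hfix : R.symm (q t - x₀) = q t - x₀ := by
    by_contra hne
    exact hA ⟨t, ht, sub_ne_zero.2 (Ne.symm hne)⟩
  have hfix' : R (q t - x₀) = q t - x₀ := by
    conv_lhs => rw [← hfix]
    rw [LinearIsometryEquiv.apply_symm_apply]
  have e1 : x₀ + R y = q t + R (y - (q t - x₀)) := by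
    rw [map_sub, hfix']
    abel
  have e2 : q t + (y - (q t - x₀)) = x₀ + y := by abel
  rw [e1, hsymq t ht, e2]

/-- ★★★ **… HENCE IRROTATIONAL, OR THE VELOCITY IS EXACTLY `R`-EQUIVARIANT ABOUT `x₀` AT EVERY TIME** (chain with the all-times dichotomy
`curl_eq_zero_or_equivariant_of_curl_symmetric`, p816327): every symmetric sector of the wall is entered through ONE instant and ANY centre, and its residual
is the exact NS-invariant `R`-equivariant core. [cite: KochNadirashviliSereginSverak2009, Thm 5.2 (arXiv:0709.3599 pp. 9–10)] -/
theorem curl_eq_zero_or_equivariant_of_curl_symmetric_slice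
    (v : ℝ → EuclideanSpace ℝ (Fin 3) → EuclideanSpace ℝ (Fin 3)) (x₀ : EuclideanSpace ℝ (Fin 3))
    (hB : Literature.Analysis.FluidPDE.IsBoundedAncientMildSolution 1 v)
    (hm : ∀ t < 0, AEStronglyMeasurable (v t) volume)
    (hsm : ContDiffOn ℝ (⊤ : ℕ∞) (Function.uncurry v) (Set.Iio 0 ×ˢ Set.univ))
    (hun : ∀ t < 0, ∀ x, ⟪x - x₀, curl (v t) x⟫ = 0)
    (R : EuclideanSpace ℝ (Fin 3) ≃ₗᵢ[ℝ] EuclideanSpace ℝ (Fin 3)) (x₁ : EuclideanSpace ℝ (Fin 3)) {t₁ : ℝ} (ht₁ : t₁ < 0)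
    (hsym₁ : ∀ y, curl (v t₁) (x₁ + R y) =
      (R : EuclideanSpace ℝ (Fin 3) →L[ℝ] EuclideanSpace ℝ (Fin 3)).det • R (curl (v t₁) (x₁ + y))) :
    (∀ t < 0, ∀ x, curl (v t) x = 0) ∨ ∀ t < 0, ∀ y, v t (x₀ + R y) = R (v t (x₀ + y)) := by
  rcases curl_eq_zero_or_curl_symmetric_of_curl_symmetric_slice v x₀ hB hm hsm hun R x₁ ht₁ hsym₁ with h | h
  · exact Or.inl h
  · exact curl_eq_zero_or_equivariant_of_curl_symmetric v x₀ hB hm hsm hun R h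

/-- ★★★ **… OR, SLICE-WISE: CONSTANT, OR EXACTLY EQUIVARIANT.** [cite: KochNadirashviliSereginSverak2009, Thm 5.2 (arXiv:0709.3599 pp. 9–10)] -/
theorem constant_or_equivariant_of_curl_symmetric_slice
    (v : ℝ → EuclideanSpace ℝ (Fin 3) → EuclideanSpace ℝ (Fin 3)) (x₀ : EuclideanSpace ℝ (Fin 3))
    (hB : Literature.Analysis.FluidPDE.IsBoundedAncientMildSolution 1 v)
    (hm : ∀ t < 0, AEStronglyMeasurable (v t) volume)
    (hsm : ContDiffOn ℝ (⊤ : ℕ∞) (Function.uncurry v) (Set.Iio 0 ×ˢ Set.univ))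
    (hun : ∀ t < 0, ∀ x, ⟪x - x₀, curl (v t) x⟫ = 0)
    (R : EuclideanSpace ℝ (Fin 3) ≃ₗᵢ[ℝ] EuclideanSpace ℝ (Fin 3)) (x₁ : EuclideanSpace ℝ (Fin 3)) {t₁ : ℝ} (ht₁ : t₁ < 0)
    (hsym₁ : ∀ y, curl (v t₁) (x₁ + R y) =
      (R : EuclideanSpace ℝ (Fin 3) →L[ℝ] EuclideanSpace ℝ (Fin 3)).det • R (curl (v t₁) (x₁ + y))) :
    (∀ t < 0, ∃ b : EuclideanSpace ℝ (Fin 3), ∀ x, v t x = b) ∨ ∀ t < 0, ∀ y, v t (x₀ + R y) = R (v t (x₀ + y)) := by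
  rcases curl_eq_zero_or_equivariant_of_curl_symmetric_slice v x₀ hB hm hsm hun R x₁ ht₁ hsym₁ with h | h
  · exact Or.inl (constantOfIrrotational v hB hsm h)
  · exact Or.inr h

/-! ### A second centre at one instant -/

/-- ★★ **A SECOND CENTRE OF TANGENCY AT ONE INSTANT ⇒ IRROTATIONAL.**  If, at ONE `t₁ < 0`, the vorticity of the wall's flow (tangent to the spheres about
`x₀` at all times) is also tangent to the spheres about a point `x₁ ≠ x₀`, then `curl v ≡ 0`: `x₁ − x₀` is a flat direction at that instant (v1:
`curl_eq_zero_of_two_centres_frequently`, p816144, needed accumulating times). [cite: KochNadirashviliSereginSverak2009, Thm 5.2 (arXiv:0709.3599 pp. 9–10)] -/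
theorem curl_eq_zero_of_two_centres_slice
    (v : ℝ → EuclideanSpace ℝ (Fin 3) → EuclideanSpace ℝ (Fin 3)) (x₀ : EuclideanSpace ℝ (Fin 3))
    (hB : Literature.Analysis.FluidPDE.IsBoundedAncientMildSolution 1 v)
    (hm : ∀ t < 0, AEStronglyMeasurable (v t) volume)
    (hsm : ContDiffOn ℝ (⊤ : ℕ∞) (Function.uncurry v) (Set.Iio 0 ×ˢ Set.univ))
    (hun : ∀ t < 0, ∀ x, ⟪x - x₀, curl (v t) x⟫ = 0)
    (h₁ : ∃ t₁ < 0, ∃ x₁ : EuclideanSpace ℝ (Fin 3), x₁ ≠ x₀ ∧ ∀ x, ⟪x - x₁, curl (v t₁) x⟫ = 0) :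
    ∀ t < 0, ∀ x, curl (v t) x = 0 := by
  obtain ⟨t₁, ht₁, x₁, hx₁, htan⟩ := h₁
  refine curl_eq_zero_of_flat_direction_slice v x₀ hB hm hsm hun ⟨t₁, ht₁, x₁ - x₀, sub_ne_zero.2 hx₁, fun x => ?_⟩
  have e1 : x₁ - x₀ = (x - x₀) - (x - x₁) := by abel
  rw [e1, inner_sub_left, hun t₁ ht₁ x, htan x, sub_zero]

/-- ★★ **… HENCE SLICE-WISE CONSTANT.** [cite: KochNadirashviliSereginSverak2009, Thm 5.2 (arXiv:0709.3599 pp. 9–10)] -/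
theorem constant_of_two_centres_slice
    (v : ℝ → EuclideanSpace ℝ (Fin 3) → EuclideanSpace ℝ (Fin 3)) (x₀ : EuclideanSpace ℝ (Fin 3))
    (hB : Literature.Analysis.FluidPDE.IsBoundedAncientMildSolution 1 v)
    (hm : ∀ t < 0, AEStronglyMeasurable (v t) volume)
    (hsm : ContDiffOn ℝ (⊤ : ℕ∞) (Function.uncurry v) (Set.Iio 0 ×ˢ Set.univ))
    (hun : ∀ t < 0, ∀ x, ⟪x - x₀, curl (v t) x⟫ = 0)
    (h₁ : ∃ t₁ < 0, ∃ x₁ : EuclideanSpace ℝ (Fin 3), x₁ ≠ x₀ ∧ ∀ x, ⟪x - x₁, curl (v t₁) x⟫ = 0) :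
    ∀ t < 0, ∃ b : EuclideanSpace ℝ (Fin 3), ∀ x, v t x = b :=
  constantOfIrrotational v hB hsm (curl_eq_zero_of_two_centres_slice v x₀ hB hm hsm hun h₁)

end OneInstant

end Summit.NavierStokesRegularity.NavierStokesRegularity.Theorems.PoloidalLiouville.Antidynamo

end
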